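import Mathlib
import Literature.RepresentationTheory.Semisimple.Twist
import Literature.RepresentationTheory.Semisimple.SubrepresentationEquiv
import HarnessLib

/-!
# Clifford theory for a self-twisted reducible representation of dimension four — lemmas

Route `ExteriorSquareAscent`, crux `SelfTwistedIrreducible` (stmt-Langlands-18055), line `Sketch`,
stub `stub_cliffordDichotomy` — the purely algebraic lemmas (file 1 of 3; the dichotomy itself is
`…CliffordDichotomy.lean`, the Galois glue and the registered stub are `…StubCliffordDichotomy.lean`).

Setting: `k` an algebraically closed field, `G` a group, `H ≤ G`, `ε : G → kˣ` a character trivial on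
`H`, `ρ : G → GL(V)` a representation; an `ε`-map between `G`-stable subspaces is a linear map `S` with
`S (ρ g w) = ε(g)⁻¹ ρ g (S w)`.  Contents: characteristic polynomial of an endomorphism preserving two
complementary subspaces (`LinearMap.charpoly_eq_mul_of_isCompl`); independence bookkeeping; the SCHUR
STEP (`false_of_epsMap_of_irreducible`: a non-zero `ε`-endomorphism of a `G`-stable `W` with `W|_H`
irreducible forces `ε = 1`); the `H`-SPLITTING of a `G`-plane with no `G`-line whose restriction to the
normal index-two `H` is reducible (`exists_eigenpair_of_not_irreducible`); irreducibility of a `G`-plane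
with no `G`-line; equivariance of projections; stable complements; one-dimensional stable subspaces.

References: A. H. Clifford, Ann. of Math. 38 (1937), Thm. 1; C. W. Curtis, I. Reiner, *Methods of
Representation Theory* I (1981), §11; J.-P. Serre, *Linear representations of finite groups*, §8.1.
-/

set_option linter.dupNamespace false -- `Summit.Langlands.Langlands` is the mandated namespace

noncomputable section

namespace Summit.Langlands.Langlands.Cruxes.SelfTwistedIrreducible.DetPinning

open Literature.RepresentationTheory.Semisimple Polynomial Module

universe u v w

variable {k : Type u} [Field k] {G : Type v} [Group G] {V : Type w} [AddCommGroup V] [Module k V]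

/-! ## Linear algebra -/

/-- The characteristic polynomial of an endomorphism preserving two complementary subspaces is the
product of the characteristic polynomials of its restrictions. [folklore] -/
theorem LinearMap.charpoly_eq_mul_of_isCompl [FiniteDimensional k V] {U U' : Submodule k V}
    (hc : IsCompl U U') (f : V →ₗ[k] V) (hU : ∀ x ∈ U, f x ∈ U) (hU' : ∀ x ∈ U', f x ∈ U') :
    f.charpoly = (f.restrict hU).charpoly * (f.restrict hU').charpoly := by
  set e := Submodule.prodEquivOfIsCompl U U' hc with he
  have key : e.conj ((f.restrict hU).prodMap (f.restrict hU')) = f := by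
    apply LinearMap.ext
    intro v
    obtain ⟨p, rfl⟩ := e.surjective v
    rw [LinearEquiv.conj_apply_apply, LinearEquiv.symm_apply_apply]
    obtain ⟨a, b⟩ := p
    simp [he, Submodule.coe_prodEquivOfIsCompl', LinearMap.prodMap_apply, LinearMap.restrict_apply]
  calc f.charpoly = (e.conj ((f.restrict hU).prodMap (f.restrict hU'))).charpoly := by rw [key]
    _ = _ := by rw [LinearEquiv.charpoly_conj, LinearMap.charpoly_prodMap]

/-- Four vectors, two independent ones in `P` and two independent ones in `Q` with `P ⊓ Q = ⊥`, are
linearly independent. [folklore] -/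
theorem linearIndependent_four_of_disjoint {P Q : Submodule k V} (hPQ : Disjoint P Q)
    {a b c d : V} (ha : a ∈ P) (hb : b ∈ P) (hc : c ∈ Q) (hd : d ∈ Q)
    (hab : LinearIndependent k ![a, b]) (hcd : LinearIndependent k ![c, d]) :
    LinearIndependent k ![a, b, c, d] := by
  rw [Fintype.linearIndependent_iff]
  intro g hg i
  rw [Fin.sum_univ_four] at hg
  simp only [Matrix.cons_val_zero, Matrix.cons_val_one, Matrix.cons_val] at hg
  have hp : g 0 • a + g 1 • b ∈ P := P.add_mem (P.smul_mem _ ha) (P.smul_mem _ hb)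
  have hq : g 2 • c + g 3 • d ∈ Q := Q.add_mem (Q.smul_mem _ hc) (Q.smul_mem _ hd)
  have hsum : (g 0 • a + g 1 • b) + (g 2 • c + g 3 • d) = 0 := by rw [← hg]; abel
  have hp0 : g 0 • a + g 1 • b = 0 := by
    have hneg : g 0 • a + g 1 • b = -(g 2 • c + g 3 • d) := eq_neg_of_add_eq_zero_left hsum
    have hmemQ : g 0 • a + g 1 • b ∈ Q := by rw [hneg]; exact Q.neg_mem hq
    exact (Submodule.disjoint_def.mp hPQ) _ hp hmemQ
  have hq0 : g 2 • c + g 3 • d = 0 := by rwa [hp0, zero_add] at hsum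
  obtain ⟨h0, h1⟩ := LinearIndependent.pair_iff.mp hab _ _ hp0
  obtain ⟨h2, h3⟩ := LinearIndependent.pair_iff.mp hcd _ _ hq0
  fin_cases i <;> assumption

/-- Two vectors spanning distinct lines are linearly independent: if `x ≠ 0` and `x' ∉ span {x}`. -/
theorem linearIndependent_pair_of_not_mem_span {x x' : V} (hx : x ≠ 0)
    (hx' : x' ∉ Submodule.span k {x}) : LinearIndependent k ![x, x'] := by
  rw [LinearIndependent.pair_iff]
  intro s t hst
  by_cases ht : t = 0
  · subst ht
    rw [zero_smul, add_zero] at hst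
    exact ⟨(smul_eq_zero.mp hst).resolve_right hx, rfl⟩
  · exfalso
    apply hx'
    have : x' = (-(t⁻¹ * s)) • x := by
      have h1 : t • x' = -(s • x) := eq_neg_of_add_eq_zero_right hst
      calc x' = t⁻¹ • (t • x') := by rw [smul_smul, inv_mul_cancel₀ ht, one_smul]
        _ = _ := by rw [h1, smul_neg, smul_smul, neg_smul]
    rw [this]
    exact Submodule.smul_mem _ _ (Submodule.mem_span_singleton_self x)

/-! ## The setting: `ε`-maps, Schur, `H`-splitting -/

section Setting

variable [IsAlgClosed k] [FiniteDimensional k V]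
  {H : Subgroup G} {ε : G →* kˣ} {ρ : Representation k G V}

omit [IsAlgClosed k] [FiniteDimensional k V] in
/-- `ρ(g)` is injective. -/
theorem rep_apply_eq_zero {g : G} {v : V} (h : ρ g v = 0) : v = 0 := by
  have : ρ g⁻¹ (ρ g v) = v := by
    rw [← Module.End.mul_apply, ← map_mul, inv_mul_cancel, map_one, Module.End.one_apply]
  rw [← this, h, map_zero]

/-- **Schur step.** If `W ≠ 0` is `G`-stable, `W|_H` is irreducible, and `S : W → W` is a NON-ZERO
`ε`-semilinear `G`-map (`S (ρ g w) = ε(g)⁻¹ ρ g (S w)`), then every `ε(g)` is `1`; so an element `g₀`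
with `ε(g₀) ≠ 1` is contradictory.  (Over an algebraically closed field, `S` is an `H`-endomorphism of
the irreducible `W|_H`, hence a scalar `c ≠ 0` by Schur, and `c ρ(g₀) w = ε(g₀)⁻¹ c ρ(g₀) w`.)
[folklore] -/
theorem false_of_epsMap_of_irreducible (hε : ∀ g ∈ H, ε g = 1) {g₀ : G} (hg₀ : ε g₀ ≠ 1)
    {W : Submodule k V} (hW : ∀ g, ∀ x ∈ W, ρ g x ∈ W) (hW0 : W ≠ ⊥) {S : W →ₗ[k] W}
    (hS : ∀ (g : G) (w : W), (S ⟨ρ g w, hW g w w.2⟩ : V) = (((ε g)⁻¹ : kˣ) : k) • ρ g (S w))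
    (hS0 : S ≠ 0)
    (hirr : Representation.IsIrreducible
      ((⟨W, fun g _ hx => hW g _ hx⟩ : Subrepresentation ρ).toRepresentation.comp H.subtype)) :
    False := by
  set Wρ : Subrepresentation ρ := ⟨W, fun g _ hx => hW g _ hx⟩ with hWρ
  set σ : Representation k H W := Wρ.toRepresentation.comp H.subtype with hσdef
  haveI : σ.IsIrreducible := hirr
  have hσ : ∀ (h : H) (w : W), (σ h w : V) = ρ h w := fun h w => rfl
  -- `S` is an `H`-intertwiner
  have hint : ∀ (h : H) (w : W), S (σ h w) = σ h (S w) := by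
    intro h w
    apply Subtype.ext
    have h1 := hS h w
    rw [hε h h.2, inv_one, Units.val_one, one_smul] at h1
    have h2 : σ h w = ⟨ρ h w, hW h w w.2⟩ := Subtype.ext (hσ h w)
    rw [h2, h1, hσ]
  let I : Representation.IntertwiningMap σ σ :=
    LinearMap.intertwiningMap_of_isIntertwiningMap σ σ S hint
  obtain ⟨c, hc⟩ :=
    (Representation.IsIrreducible.algebraMap_intertwiningMap_bijective_of_isAlgClosed (ρ := σ)).2 I
  have hSc : ∀ w : W, S w = c • w := by
    intro w
    have := congrArg (fun J : Representation.IntertwiningMap σ σ => J w) hc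
    simp only [Representation.IntertwiningMap.algebraMap_apply,
      Representation.IntertwiningMap.smul_apply] at this
    -- `(1 : IntertwiningMap σ σ) w = w`
    rw [show ((1 : Representation.IntertwiningMap σ σ) : W → W) w = w from rfl] at this
    exact this.symm
  -- `c ≠ 0`
  have hc0 : c ≠ 0 := by
    rintro rfl
    apply hS0
    apply LinearMap.ext
    intro w
    rw [hSc, zero_smul, LinearMap.zero_apply]
  -- a non-zero vector of `W`
  obtain ⟨w, hwW, hw0⟩ := (Submodule.ne_bot_iff W).mp hW0
  have key := hS g₀ ⟨w, hwW⟩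
  rw [hSc, hSc, Submodule.coe_smul, Submodule.coe_smul, map_smul] at key
  -- `c • ρ g₀ w = (ε g₀)⁻¹ • c • ρ g₀ w`
  have hne : ρ g₀ w ≠ 0 := fun h => hw0 (rep_apply_eq_zero h)
  have : (c - (((ε g₀)⁻¹ : kˣ) : k) * c) • ρ g₀ w = 0 := by
    rw [sub_smul, mul_smul]
    exact sub_eq_zero.mpr key
  rcases smul_eq_zero.mp this with h | h
  · apply hg₀
    have h' : (((ε g₀)⁻¹ : kˣ) : k) = 1 := by
      have : (1 - (((ε g₀)⁻¹ : kˣ) : k)) * c = 0 := by rw [sub_mul, one_mul]; exact h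
      rcases mul_eq_zero.mp this with h1 | h1
      · exact (sub_eq_zero.mp h1).symm
      · exact absurd h1 hc0
    have : (ε g₀)⁻¹ = 1 := Units.ext (by rw [h', Units.val_one])
    exact inv_eq_one.mp this
  · exact absurd h hne

omit [IsAlgClosed k] in
/-- **`H`-splitting of a `G`-plane.** If the `G`-stable plane `W` contains no `G`-stable line but its
restriction to `H` is reducible, then `W` contains two independent `H`-eigenvectors `x, x'` (take an
`H`-stable line `⟨x⟩` and `x' = ρ(g₀) x`, `g₀ ∉ H`; `H` is normal and `G = H ∪ g₀H`). [folklore] -/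
theorem exists_eigenpair_of_not_irreducible [H.Normal] {g₀ : G} (hg₀ : g₀ ∉ H)
    (hmul : ∀ a b : G, a ∉ H → b ∉ H → a⁻¹ * b ∈ H)
    {W : Submodule k V} (hW : ∀ g, ∀ x ∈ W, ρ g x ∈ W) (hW2 : finrank k W = 2)
    (hnoline : ∀ x ∈ W, x ≠ 0 → (∀ g, ρ g x ∈ Submodule.span k {x}) → False)
    (hred : ¬ Representation.IsIrreducible
      ((⟨W, fun g _ hx => hW g _ hx⟩ : Subrepresentation ρ).toRepresentation.comp H.subtype)) :
    ∃ x x' : V, x ∈ W ∧ x' ∈ W ∧ LinearIndependent k ![x, x'] ∧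
      (∀ g ∈ H, ∃ c : k, ρ g x = c • x) ∧ (∀ g ∈ H, ∃ c : k, ρ g x' = c • x') := by
  set Wρ : Subrepresentation ρ := ⟨W, fun g _ hx => hW g _ hx⟩ with hWρ
  set σ : Representation k H W := Wρ.toRepresentation.comp H.subtype with hσdef
  have hσ : ∀ (h : H) (w : W), (σ h w : V) = ρ h w := fun h w => rfl
  -- a proper non-zero `H`-subrepresentation of `W`
  obtain ⟨X, hX0, hX1⟩ : ∃ X : Subrepresentation σ, X ≠ ⊥ ∧ X ≠ ⊤ := by
    by_contra hno
    push Not at hno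
    apply hred
    have hbt : (⊥ : Subrepresentation σ) ≠ ⊤ := by
      intro h
      have h' := congrArg Subrepresentation.toSubmodule h
      change (⊥ : Submodule k W) = ⊤ at h'
      have : finrank k (⊤ : Submodule k W) = 0 := by rw [← h', finrank_bot]
      rw [finrank_top, hW2] at this
      exact absurd this (by norm_num)
    exact { exists_pair_ne := ⟨⊥, ⊤, hbt⟩,
            eq_bot_or_eq_top := fun X => (eq_or_ne X ⊥).imp_right (hno X) }
  -- it is a line `⟨x₀⟩`
  have hXd : finrank k X.toSubmodule = 1 := by
    have h1 : finrank k X.toSubmodule < 2 := by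
      rw [← hW2, ← finrank_top (R := k) (M := W)]
      exact Submodule.finrank_lt_finrank_of_lt (lt_top_iff_ne_top.mpr fun h =>
        hX1 (Subrepresentation.toSubmodule_injective h))
    have h2 : finrank k X.toSubmodule ≠ 0 := fun h =>
      hX0 (Subrepresentation.toSubmodule_injective (Submodule.finrank_eq_zero.mp h))
    omega
  obtain ⟨x₀, hx₀0, hx₀⟩ := finrank_eq_one_iff'.mp hXd
  set x : V := ((x₀ : W) : V) with hxdef
  have hxW : x ∈ W := (x₀ : W).2
  have hx0 : x ≠ 0 := by
    intro h
    apply hx₀0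
    exact Subtype.ext (Subtype.ext h)
  -- `x` is an `H`-eigenvector
  have hxH : ∀ g ∈ H, ∃ c : k, ρ g x = c • x := by
    intro g hg
    have hmem : σ ⟨g, hg⟩ (x₀ : W) ∈ X.toSubmodule := X.apply_mem_toSubmodule ⟨g, hg⟩ x₀.2
    obtain ⟨c, hc⟩ := hx₀ ⟨_, hmem⟩
    refine ⟨c, ?_⟩
    have := congrArg (fun y : X.toSubmodule => (((y : W)) : V)) hc
    simp only [Submodule.coe_smul] at this
    rw [← hσ ⟨g, hg⟩, ← this]
  -- `x' = ρ g₀ x`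
  set x' : V := ρ g₀ x with hx'def
  have hx'W : x' ∈ W := hW g₀ x hxW
  have hx'H : ∀ g ∈ H, ∃ c : k, ρ g x' = c • x' := by
    intro g hg
    have hconj : g₀⁻¹ * g * g₀ ∈ H := by
      have := ‹H.Normal›.conj_mem _ hg g₀⁻¹
      rwa [inv_inv] at this
    obtain ⟨c, hc⟩ := hxH _ hconj
    refine ⟨c, ?_⟩
    calc ρ g x' = ρ (g₀ * (g₀⁻¹ * g * g₀)) x := by
          rw [hx'def, ← Module.End.mul_apply, ← map_mul]; congr 1; group
      _ = ρ g₀ (ρ (g₀⁻¹ * g * g₀) x) := by rw [map_mul, Module.End.mul_apply]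
      _ = c • x' := by rw [hc, map_smul]
  -- `x, x'` independent (otherwise `⟨x⟩` would be `G`-stable)
  have hind : LinearIndependent k ![x, x'] := by
    refine linearIndependent_pair_of_not_mem_span hx0 fun hmem => ?_
    apply hnoline x hxW hx0
    intro g
    by_cases hg : g ∈ H
    · obtain ⟨c, hc⟩ := hxH g hg
      rw [hc]
      exact Submodule.smul_mem _ _ (Submodule.mem_span_singleton_self x)
    · have hg' : g₀⁻¹ * g ∈ H := hmul g₀ g hg₀ hg
      obtain ⟨c, hc⟩ := hxH _ hg'
      obtain ⟨a, ha⟩ := Submodule.mem_span_singleton.mp hmem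
      have : ρ g x = (c * a) • x := by
        calc ρ g x = ρ (g₀ * (g₀⁻¹ * g)) x := by rw [mul_inv_cancel_left]
          _ = ρ g₀ (ρ (g₀⁻¹ * g) x) := by rw [map_mul, Module.End.mul_apply]
          _ = c • x' := by rw [hc, map_smul]
          _ = (c * a) • x := by rw [← ha, smul_smul]
      rw [this]
      exact Submodule.smul_mem _ _ (Submodule.mem_span_singleton_self x)
  exact ⟨x, x', hxW, hx'W, hind, hxH, hx'H⟩

omit [IsAlgClosed k] in
/-- A `G`-stable plane with no `G`-stable line is irreducible. [folklore] -/
theorem isIrreducible_of_noline {W : Submodule k V} (hW : ∀ g, ∀ x ∈ W, ρ g x ∈ W)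
    (hW2 : finrank k W = 2)
    (hnoline : ∀ x ∈ W, x ≠ 0 → (∀ g, ρ g x ∈ Submodule.span k {x}) → False) :
    Representation.IsIrreducible
      ((⟨W, fun g _ hx => hW g _ hx⟩ : Subrepresentation ρ).toRepresentation) := by
  set Wρ : Subrepresentation ρ := ⟨W, fun g _ hx => hW g _ hx⟩ with hWρ
  set σ := Wρ.toRepresentation with hσdef
  have hσ : ∀ (g : G) (w : W), (σ g w : V) = ρ g w := fun g w => rfl
  have hbt : (⊥ : Subrepresentation σ) ≠ ⊤ := by
    intro h
    have h' := congrArg Subrepresentation.toSubmodule h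
    change (⊥ : Submodule k W) = ⊤ at h'
    have : finrank k (⊤ : Submodule k W) = 0 := by rw [← h', finrank_bot]
    rw [finrank_top, hW2] at this
    exact absurd this (by norm_num)
  refine { exists_pair_ne := ⟨⊥, ⊤, hbt⟩, eq_bot_or_eq_top := fun X => ?_ }
  by_contra hX
  push Not at hX
  obtain ⟨hX0, hX1⟩ := hX
  have hXd : finrank k X.toSubmodule = 1 := by
    have h1 : finrank k X.toSubmodule < 2 := by
      rw [← hW2, ← finrank_top (R := k) (M := W)]
      exact Submodule.finrank_lt_finrank_of_lt (lt_top_iff_ne_top.mpr fun h =>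
        hX1 (Subrepresentation.toSubmodule_injective h))
    have h2 : finrank k X.toSubmodule ≠ 0 := fun h =>
      hX0 (Subrepresentation.toSubmodule_injective (Submodule.finrank_eq_zero.mp h))
    omega
  obtain ⟨x₀, hx₀0, hx₀⟩ := finrank_eq_one_iff'.mp hXd
  set x : V := ((x₀ : W) : V) with hxdef
  have hx0 : x ≠ 0 := fun h => hx₀0 (Subtype.ext (Subtype.ext h))
  refine hnoline x (x₀ : W).2 hx0 fun g => ?_
  have hmem : σ g (x₀ : W) ∈ X.toSubmodule := X.apply_mem_toSubmodule g x₀.2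
  obtain ⟨c, hc⟩ := hx₀ ⟨_, hmem⟩
  have := congrArg (fun y : X.toSubmodule => (((y : W)) : V)) hc
  simp only [Submodule.coe_smul] at this
  rw [← hσ g, ← this]
  exact Submodule.smul_mem _ _ (Submodule.mem_span_singleton_self x)


/-! ## The dichotomy -/

omit [IsAlgClosed k] [FiniteDimensional k V] in
/-- The projection onto a `G`-stable subspace along a `G`-stable complement commutes with `ρ`. -/
theorem projectionOnto_rep {P Q : Submodule k V} (hPQ : IsCompl P Q)
    (hP : ∀ g, ∀ x ∈ P, ρ g x ∈ P) (hQ : ∀ g, ∀ x ∈ Q, ρ g x ∈ Q) (g : G) (v : V) :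
    (P.projectionOnto Q hPQ (ρ g v) : V) = ρ g (P.projectionOnto Q hPQ v) := by
  set a : V := (P.projectionOnto Q hPQ v : V) with ha
  have haP : a ∈ P := (P.projectionOnto Q hPQ v).2
  have hbQ : v - a ∈ Q := Submodule.sub_projection_mem hPQ v
  have h1 : ρ g v = ρ g a + ρ g (v - a) := by rw [← map_add, add_sub_cancel]
  rw [h1, map_add, Submodule.projectionOnto_apply_of_mem_left hPQ (hP g a haP),
    (Submodule.projectionOnto_apply_eq_zero_iff hPQ).mpr (hQ g _ hbQ), add_zero]

omit [IsAlgClosed k] [FiniteDimensional k V] in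
/-- A `G`-stable subspace, as a subrepresentation, has a `G`-stable complement when `ρ` is
semisimple. -/
theorem exists_isCompl_stable [ρ.IsSemisimpleRepresentation] {P : Submodule k V}
    (hP : ∀ g, ∀ x ∈ P, ρ g x ∈ P) :
    ∃ Q : Submodule k V, (∀ g, ∀ x ∈ Q, ρ g x ∈ Q) ∧ IsCompl P Q := by
  obtain ⟨Qρ, hQρ⟩ := exists_isCompl (⟨P, fun g _ hx => hP g _ hx⟩ : Subrepresentation ρ)
  exact ⟨Qρ.toSubmodule, fun g x hx => Qρ.apply_mem_toSubmodule g hx,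
    Subrepresentation.isCompl_iff.mp hQρ⟩

omit [IsAlgClosed k] in
/-- A one-dimensional `G`-stable subspace is a `G`-stable line `⟨x⟩`. -/
theorem exists_line_of_finrank_eq_one {P : Submodule k V} (hP : ∀ g, ∀ x ∈ P, ρ g x ∈ P)
    (h1 : finrank k P = 1) : ∃ x ∈ P, x ≠ 0 ∧ ∀ g, ρ g x ∈ Submodule.span k {x} := by
  obtain ⟨x₀, hx₀0, hx₀⟩ := finrank_eq_one_iff'.mp h1
  refine ⟨(x₀ : V), x₀.2, fun h => hx₀0 (Subtype.ext h), fun g => ?_⟩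
  obtain ⟨c, hc⟩ := hx₀ ⟨ρ g x₀, hP g _ x₀.2⟩
  have := congrArg (fun y : P => (y : V)) hc
  simp only [Submodule.coe_smul] at this
  rw [← this]
  exact Submodule.smul_mem _ _ (Submodule.mem_span_singleton_self _)

end Setting

end Summit.Langlands.Langlands.Cruxes.SelfTwistedIrreducible.DetPinning

end
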